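import Mathlib
import Summits.NavierStokesRegularity.NavierStokesRegularity.Theorems.EulerZoomLiouvillePowerGaugeEulerLiouvilleEvanescentPatternPast
import HarnessLib

/-!
# Crux `EulerZoomLiouville.PowerGaugeEulerLiouville` (stmt-NavierStokesRegularity-19832), stub `stub_nonSelfSimilarRest`:
# a steady field plus a pattern with LINEAR-ODE modulation `θ' = α + βθ` is trivial (all cases)

Helper file (theorems only; `--supports stmt-NavierStokesRegularity-19832`; def-free).  Hand leafhand-ns-eulerzoomliouville-11 g0;
the `γ = 0` slice of the Riccati residual (census T-f): `θ' = α + βθ` on `(−∞,T₁)`, `θ ∈ C¹(ℝ)`.  Solutions: `θ₀ + αt` (`β = 0`),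
`−α/β + K e^{βt}` (`β ≠ 0`); each branch is killed by a landed stratum — affine (`…AffineTimePast`), constant (`AePastSteady`),
exponentially GROWING toward the past (`β < 0`, `K ≠ 0`: `…SupercriticalModulationPast`), exponentially EVANESCENT (`β > 0`,
`K ≠ 0`: `…EvanescentPatternPast`, tail `∫ K²e^{2βt} = K²e^{2βT₁}/(2β)`).  Result: `Linear.ae_eq_zero_of_gauge_of_aeLinearODEPattern`,
binder `Birth.nonSelfSimilar_of_aeLinearODEPattern` (`0 < ρ ≤ ½`).

WHAT THIS IS NOT: not a proof of the stub or of the crux; nothing about Navier–Stokes. [folklore]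
-/

noncomputable section

-- flat `Theorems/<Route><Decl>…` files of one crux share the namespace of the crux (tree convention)
set_option linter.dupNamespace false

open MeasureTheory Set Filter Topology Metric Function TopologicalSpace
open scoped RealInnerProductSpace NNReal ENNReal

namespace Summit.NavierStokesRegularity.NavierStokesRegularity.Theorems.PowerGaugeEulerLiouville

open Literature.Analysis Literature.Analysis.FunctionSpaces Literature.Analysis.FluidPDE

namespace Linear

/-- The linear ODE `θ' = α + βθ` on `(−∞,T₁)` solved: `β = 0` ⇒ `θ(t) = θ(t₀) + α(t − t₀)`; `β ≠ 0` ⇒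
`θ(t) = −α/β + (θ(t₀) + α/β) e^{β(t − t₀)}` (`t, t₀ < T₁`). [folklore] -/
theorem linearODE_solution {θ : ℝ → ℝ} (hθ1 : ContDiff ℝ 1 θ) {α β T₁ : ℝ}
    (hode : ∀ t, t < T₁ → deriv θ t = α + β * θ t) {t₀ : ℝ} (ht₀ : t₀ < T₁) :
    (β = 0 → ∀ t, t < T₁ → θ t = θ t₀ + α * (t - t₀)) ∧
    (β ≠ 0 → ∀ t, t < T₁ → θ t = -α / β + (θ t₀ + α / β) * Real.exp (β * (t - t₀))) := by
  have hθd : ∀ t, HasDerivAt θ (deriv θ t) t := fun t => (hθ1.differentiable (by norm_num) t).hasDerivAt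
  constructor
  · intro hβ t ht
    set f : ℝ → ℝ := fun s => θ s - α * s with hf
    have hf' : ∀ s, s < T₁ → HasDerivAt f 0 s := by
      intro s hs
      have h := (hθd s).sub ((hasDerivAt_id s).const_mul α)
      rw [hode s hs, hβ] at h
      exact h.congr_deriv (by simp)
    have h := isOpen_Iio.is_const_of_deriv_eq_zero isPreconnected_Iio
      (fun s hs => (hf' s hs).differentiableAt.differentiableWithinAt) (fun s hs => (hf' s hs).deriv) ht ht₀
    simp only [hf] at h
    linarith
  · intro hβ t ht
    set f : ℝ → ℝ := fun s => (θ s + α / β) * Real.exp (-(β * s)) with hf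
    have hf' : ∀ s, s < T₁ → HasDerivAt f 0 s := by
      intro s hs
      have h1 : HasDerivAt (fun s => θ s + α / β) (deriv θ s) s := (hθd s).add_const _
      have h2 : HasDerivAt (fun s => Real.exp (-(β * s))) (Real.exp (-(β * s)) * (-(β * 1))) s :=
        (((hasDerivAt_id s).const_mul β).neg).exp
      have h := h1.mul h2
      rw [hode s hs] at h
      exact h.congr_deriv (by field_simp; ring)
    have h := isOpen_Iio.is_const_of_deriv_eq_zero isPreconnected_Iio
      (fun s hs => (hf' s hs).differentiableAt.differentiableWithinAt) (fun s hs => (hf' s hs).deriv) ht ht₀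
    simp only [hf] at h
    -- `(θ t + α/β) e^{-βt} = (θ t₀ + α/β) e^{-βt₀}`
    have he : Real.exp (-(β * t)) ≠ 0 := (Real.exp_pos _).ne'
    have key : θ t + α / β = (θ t₀ + α / β) * Real.exp (β * (t - t₀)) := by
      have e1 : Real.exp (β * (t - t₀)) = Real.exp (-(β * t₀)) / Real.exp (-(β * t)) := by
        rw [← Real.exp_sub]; congr 1; ring
      rw [e1, mul_div_assoc', eq_div_iff he, h]
    rw [neg_div]
    linarith [key]

/-- The square-integrable tail of an evanescent exponential: `∫_{(−b²,T₁)} (K e^{βt})² ≤ K² e^{2βT₁}/(2β)` (`β > 0`). [folklore] -/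
theorem lintegral_exp_tail_le {K β T₁ : ℝ} (hβ : 0 < β) (b : ℝ) :
    ∫⁻ t in Ioo (-(b ^ 2)) T₁, ‖K * Real.exp (β * t)‖ₑ ^ 2 ≤ ENNReal.ofReal (K ^ 2 * Real.exp (2 * β * T₁) / (2 * β)) := by
  have e : ∀ t : ℝ, ‖K * Real.exp (β * t)‖ₑ ^ 2 = ENNReal.ofReal (K ^ 2 * Real.exp (2 * β * t)) := by
    intro t
    rw [Real.enorm_eq_ofReal_abs, ← ENNReal.ofReal_pow (abs_nonneg _), sq_abs, mul_pow, ← Real.exp_nat_mul]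
    congr 2; push_cast; ring
  simp_rw [e]
  have hint : IntegrableOn (fun t => K ^ 2 * Real.exp (2 * β * t)) (Iic T₁) volume :=
    (integrableOn_exp_mul_Iic (by linarith) T₁).const_mul _
  calc ∫⁻ t in Ioo (-(b ^ 2)) T₁, ENNReal.ofReal (K ^ 2 * Real.exp (2 * β * t))
      ≤ ∫⁻ t in Iic T₁, ENNReal.ofReal (K ^ 2 * Real.exp (2 * β * t)) := lintegral_mono_set fun t ht => ht.2.le
    _ = ENNReal.ofReal (∫ t in Iic T₁, K ^ 2 * Real.exp (2 * β * t)) := by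
        rw [ofReal_integral_eq_lintegral_ofReal hint (ae_of_all _ fun t => by positivity)]
    _ = ENNReal.ofReal (K ^ 2 * Real.exp (2 * β * T₁) / (2 * β)) := by
        rw [integral_const_mul, integral_exp_mul_Iic (by linarith)]
        congr 1; ring

/-- Super-critical growth of `r + K e^{βt}` toward the past for `β < 0`, `K ≠ 0`: `|θ(t)|/|t|^e → ∞` as `t → −∞` for every
`e ≥ 0`, whenever `θ` agrees with `r + K e^{βt}` on `(−∞,T₁)`. [folklore] -/
theorem tendsto_supercritical_of_exp {θ : ℝ → ℝ} {r K β T₁ e : ℝ} (hβ : β < 0) (hK : K ≠ 0) (he : 0 ≤ e)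
    (hθ : ∀ t, t < T₁ → θ t = r + K * Real.exp (β * t)) :
    Tendsto (fun t : ℝ => |θ t| / |t| ^ e) atBot atTop := by
  -- compare with `x ↦ |K| e^{|β| x} / x^e − |r|` along `x = −t → +∞`
  have hg : Tendsto (fun x : ℝ => |K| * (Real.exp (-β * x) / x ^ e) - |r|) atTop atTop := by
    have h1 := tendsto_exp_mul_div_rpow_atTop e (-β) (by linarith)
    have h2 : Tendsto (fun x : ℝ => |K| * (Real.exp (-β * x) / x ^ e)) atTop atTop :=
      h1.const_mul_atTop (abs_pos.2 hK)
    exact tendsto_atTop_add_const_right _ (-|r|) h2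
  have hcomp := hg.comp tendsto_neg_atBot_atTop
  refine tendsto_atTop_mono' atBot ?_ hcomp
  filter_upwards [eventually_lt_atBot (min T₁ (-1))] with t ht
  have htT : t < T₁ := lt_of_lt_of_le ht (min_le_left _ _)
  have ht0 : t < 0 := by have := lt_of_lt_of_le ht (min_le_right _ _); linarith
  have hpow : 0 < |t| ^ e := Real.rpow_pos_of_pos (abs_pos.2 ht0.ne) _
  have hpow1 : 1 ≤ |t| ^ e :=
    Real.one_le_rpow (by rw [abs_of_neg ht0]; have := lt_of_lt_of_le ht (min_le_right _ _); linarith) he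
  have hneg : (-t) ^ e = |t| ^ e := by rw [abs_of_neg ht0]
  show |K| * (Real.exp (-β * -t) / (-t) ^ e) - |r| ≤ |θ t| / |t| ^ e
  rw [hneg, hθ t htT, le_div_iff₀ hpow, sub_mul, mul_assoc, div_mul_cancel₀ _ hpow.ne',
    show -β * -t = β * t by ring]
  have hK' : |K * Real.exp (β * t)| = |K| * Real.exp (β * t) := by
    rw [abs_mul, abs_of_pos (Real.exp_pos _)]
  have htri : |K * Real.exp (β * t)| - |r| ≤ |r + K * Real.exp (β * t)| := by
    have := abs_sub_abs_le_abs_sub (K * Real.exp (β * t)) (-r)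
    rw [sub_neg_eq_add, add_comm, abs_neg] at this
    linarith
  have hr0 : |r| ≤ |r| * |t| ^ e := le_mul_of_one_le_right (abs_nonneg _) hpow1
  linarith [hK', htri, hr0]

/-- **LINEAR-ODE MODULATED PATTERNS ARE TRIVIAL** (`0 < ρ ≤ ½`): `u = U₀(x) + θ(τ)U₁(x)` a.e. on a past slab with `θ ∈ C¹(ℝ)`,
`θ' = α + βθ` on `(−∞,T₁)` ⇒ `u = 0` a.e. (all four branches of the solution formula). [folklore] -/
theorem ae_eq_zero_of_gauge_of_aeLinearODEPattern {ρ : ℝ} (hρ : 0 < ρ) (hρh : ρ ≤ 1 / 2)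
    {u : ℝ → EuclideanSpace ℝ (Fin 3) → EuclideanSpace ℝ (Fin 3)} {p : ℝ → EuclideanSpace ℝ (Fin 3) → ℝ}
    {H : ℝ → EuclideanSpace ℝ (Fin 3) → EuclideanSpace ℝ (Fin 3) →L[ℝ] EuclideanSpace ℝ (Fin 3)} {c : ℝ≥0}
    (hsw : IsSuitableWeakSolutionOn (slab (EuclideanSpace ℝ (Fin 3)) (Iio 0) isOpen_Iio) 0 0 u p)
    (hH : HasWeakSpatialGradientOn (slab (EuclideanSpace ℝ (Fin 3)) (Iio 0) isOpen_Iio) u H)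
    (hc : ∀ a : ℝ, 0 < a → ENNReal.ofReal (a ^ (2 * ρ)) * cknA a (0 : ℝ × EuclideanSpace ℝ (Fin 3)) u +
        ENNReal.ofReal (a ^ ρ) * cknE a (0 : ℝ × EuclideanSpace ℝ (Fin 3)) H +
        ENNReal.ofReal (a ^ (2 * ρ)) * cknD a (0 : ℝ × EuclideanSpace ℝ (Fin 3)) p ≤ (c : ℝ≥0∞))
    {T₁ : ℝ} (hT₁ : T₁ ≤ 0) {θ : ℝ → ℝ} (hθ1 : ContDiff ℝ 1 θ) {α β : ℝ}
    (hode : ∀ t, t < T₁ → deriv θ t = α + β * θ t)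
    {U₀ U₁ : EuclideanSpace ℝ (Fin 3) → EuclideanSpace ℝ (Fin 3)}
    (hU : ∀ᵐ z ∂(volume.restrict (Iio T₁ ×ˢ (univ : Set (EuclideanSpace ℝ (Fin 3))))),
      u z.1 z.2 = U₀ z.2 + θ z.1 • U₁ z.2) :
    uncurry u =ᵐ[volume.restrict (Iio (0 : ℝ) ×ˢ (univ : Set (EuclideanSpace ℝ (Fin 3))))] 0 := by
  have ht₀ : T₁ - 1 < T₁ := by linarith
  obtain ⟨hzero, hne⟩ := linearODE_solution hθ1 hode ht₀
  set t₀ : ℝ := T₁ - 1 with ht₀def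
  have hmem : ∀ᵐ z ∂(volume.restrict (Iio T₁ ×ˢ (univ : Set (EuclideanSpace ℝ (Fin 3))))),
      z ∈ Iio T₁ ×ˢ (univ : Set (EuclideanSpace ℝ (Fin 3))) := ae_restrict_mem (measurableSet_Iio.prod MeasurableSet.univ)
  by_cases hβ : β = 0
  · -- affine modulation
    have hθ := hzero hβ
    refine AffinePast.ae_eq_zero_of_gauge_of_aeAffinePast hρ hsw hH hc hT₁
      (U₀ := fun x => U₀ x + (θ t₀ - α * t₀) • U₁ x) (U₁ := fun x => α • U₁ x) ?_
    filter_upwards [hU, hmem] with z hz hzm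
    rw [hz, hθ z.1 (mem_prod.1 hzm).1, smul_smul]
    rw [show θ t₀ + α * (z.1 - t₀) = (θ t₀ - α * t₀) + z.1 * α by ring, add_smul]
    abel
  · have hθ := hne hβ
    set r : ℝ := -α / β with hr
    set K : ℝ := (θ t₀ + α / β) * Real.exp (-(β * t₀)) with hKdef
    have hθ' : ∀ t, t < T₁ → θ t = r + K * Real.exp (β * t) := by
      intro t ht
      rw [hθ t ht, hKdef, mul_assoc, ← Real.exp_add]
      congr 2; ring
    by_cases hK : K = 0
    · -- constant modulation: a.e. steady
      refine AePastSteady.ae_eq_zero_of_gauge_of_aePastSteady hρ hsw hH hc hT₁ (U := fun x => U₀ x + r • U₁ x) ?_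
      filter_upwards [hU, hmem] with z hz hzm
      rw [hz, hθ' z.1 (mem_prod.1 hzm).1, hK, zero_mul, add_zero]
    rcases lt_or_gt_of_ne hβ with hβneg | hβpos
    · -- exponentially growing toward the past: super-critical modulation
      refine ModulatedPast.ae_eq_zero_of_gauge_of_aeModulatedPast hρ hρh hsw hH hc hT₁ (θ := θ) (U₀ := U₀) (U₁ := U₁) ?_ hU
      exact tendsto_supercritical_of_exp hβneg hK (by linarith) hθ'
    · -- exponentially evanescent: the two-pattern `E`-gauge stratum after renormalisation
      refine Evanescent.ae_eq_zero_of_gauge_of_aeEvanescentPattern hρ hρh hsw hH hc hT₁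
        (θ := fun t => K * Real.exp (β * t)) (U₀ := fun x => U₀ x + r • U₁ x) (U₁ := U₁) ?_ ?_ ?_ ?_
      · exact contDiff_const.mul (Real.contDiff_exp.comp (contDiff_const.mul contDiff_id))
      · have h1 : Tendsto (fun t : ℝ => β * t) atBot atBot := Tendsto.const_mul_atBot hβpos tendsto_id
        have h2 := Real.tendsto_exp_atBot.comp h1
        simpa using h2.const_mul K
      · exact ⟨K ^ 2 * Real.exp (2 * β * T₁) / (2 * β), by positivity, fun b => lintegral_exp_tail_le hβpos b⟩
      · filter_upwards [hU, hmem] with z hz hzm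
        rw [hz, hθ' z.1 (mem_prod.1 hzm).1, add_smul]
        abel

end Linear

/-- **Binder language: LINEAR-ODE MODULATED PATTERN ⇒ TRIVIAL** — `u(τ, x) = U₀(x) + θ(τ)U₁(x)` a.e. on `(−∞,T₁) × ℝ³` (`T₁ ≤ 0`;
`U₀, U₁` arbitrary; `θ ∈ C¹(ℝ)` with `θ' = α + βθ` on `(−∞,T₁)` for some constants) ⇒ `u = 0` a.e., window `0 < ρ ≤ ½`
(`Linear.ae_eq_zero_of_gauge_of_aeLinearODEPattern`). [folklore] -/
theorem Birth.nonSelfSimilar_of_aeLinearODEPattern :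
    ∀ ρ : ℝ, 0 < ρ → ρ ≤ 1 / 2 →
      ∀ (u : ℝ → EuclideanSpace ℝ (Fin 3) → EuclideanSpace ℝ (Fin 3)) (p : ℝ → EuclideanSpace ℝ (Fin 3) → ℝ)
        (H : ℝ → EuclideanSpace ℝ (Fin 3) → EuclideanSpace ℝ (Fin 3) →L[ℝ] EuclideanSpace ℝ (Fin 3)) (c : ℝ≥0),
        Birth.InClass ρ u p H c →
          (∃ T₁ : ℝ, T₁ ≤ 0 ∧ ∃ θ : ℝ → ℝ, ∃ U₀ U₁ : EuclideanSpace ℝ (Fin 3) → EuclideanSpace ℝ (Fin 3), ∃ α β : ℝ,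
              ContDiff ℝ 1 θ ∧ (∀ t, t < T₁ → deriv θ t = α + β * θ t) ∧
              ∀ᵐ z ∂(volume.restrict (Iio T₁ ×ˢ (univ : Set (EuclideanSpace ℝ (Fin 3))))),
                u z.1 z.2 = U₀ z.2 + θ z.1 • U₁ z.2) →
          uncurry u =ᵐ[volume.restrict (Iio (0 : ℝ) ×ˢ (univ : Set (EuclideanSpace ℝ (Fin 3))))] 0 := by
  intro ρ hρ hρh u p H c hcl h
  obtain ⟨T₁, hT₁, θ, U₀, U₁, α, β, hθ1, hode, hU⟩ := h
  exact Linear.ae_eq_zero_of_gauge_of_aeLinearODEPattern hρ hρh hcl.1 hcl.2.1 hcl.2.2 hT₁ hθ1 hode hU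

end Summit.NavierStokesRegularity.NavierStokesRegularity.Theorems.PowerGaugeEulerLiouville

end
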